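import Literature.NumberTheory.Automorphic.AnisotropicUnitaryGroupCompactOfPlace  -- ★ `conjLocal_apply_eq_of_smul_eq` (`(c ⊗ 1) y` read at `w` is `σ_w y_w`)
import Literature.NumberTheory.Automorphic.UnitaryGroupNonsplitPlace              -- ★ `PlacesOver.subsingleton_of_smul_eq`, `PlacesOver.eq_of_smul_eq`
import HarnessLib

/-!
# R90-TF · S3 · THEOREMS — `R90S3LocalRingIsoOfPlaceIso` ((U3) sub-brick F-c): a bi-continuous, conjugation-intertwining field
# isomorphism `ψ : L_w ≃ L′_{w′}` at NON-SPLIT places induces the socket isomorphism `Φ : L ⊗_{L⁺} L⁺_v ≃+* L′ ⊗_{L′⁺} L′⁺_{v′}`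

R90-TF section S3 (successor dealer R90-C12-plan (g2), deal 23:44:10Z «(U3) F-c → K2E3-p21»; consumer K2E3-p17 (g10), census
`R90/S3/CENSUS-U3-globalise.K2E3-p17-g10.md` §(c)(T2)); crux H413 (`stmt-HodgeConjecture-24833`, lane `--supports … --as helper`), route
`HCCMUnconditional`; serves the (U3-F) socket `stub_R90_S3_auxGlobaliseField` of `Cruxes/H413/Lines/R90_S3_LocalTransportWaveG.lean` (:645–:654), whose
`Φ`-clauses (:649–:650) are conjuncts 1–3 below VERBATIM.  THEOREMS ONLY (no `def`, no `instance`, no notation, no named fact, no `sorry`); never imports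
`Cruxes/…/Lines`.

THE MATHEMATICS [CasselsFrohlichANT1967, Ch. II §10 («`L ⊗_K K_v ≅ ∏_{w ∣ v} L_w`»); Ch. VII §1.1, Prop. 1.2 (ii)] [Rogawski1990 §13.8 p. 216 («we can choose `E∕F`
and `w` such that `E_w∕F_w` is isomorphic to `E′∕F′`»)].  The tree's semilocal ring `UnitaryGroup.LocalRing L v` is LITERALLY `Π w : PlacesOver L v, L_w`
(★ `UnitaryGroupAutomorphicRep` :299) and its conjugation `conjLocal L c v` is `(c x)_w = c_w (x_{c⁻¹ w})` (★ :305).  At a place `v` of `L⁺` that does not split in the CM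
field `L` there is exactly ONE place `w ∣ v` (★ `PlacesOver.subsingleton_of_smul_eq`), so `x ↦ x_w` is a ring isomorphism `L ⊗ L⁺_v ≃+* L_w` (Mathlib
`RingEquiv.piUnique`, a homeomorphism by `Homeomorph.piUnique`) under which `conjLocal` reads `σ_w := galAdicCompletionMap c (hw : c • w = w)` (★
`conjLocal_apply_eq_of_smul_eq`).  Hence a field isomorphism `ψ : L_w ≃+* L′_{w′}` between the completions at the unique places over two non-split places
`v, v′`, continuous in both directions and intertwining `σ_w, σ′_{w′}`, induces `Φ := (x′ ↦ x′_{w′})⁻¹ ∘ ψ ∘ (x ↦ x_w)` with the three Φ-clauses of the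
(U3-F) socket — `Continuous Φ`, `Continuous Φ.symm`, `Φ ∘ (c ⊗ 1) = (c′ ⊗ 1) ∘ Φ` — and the value clause `(Φ x)_{w′} = ψ (x_w)` read by the later `hΦH ∕ hΦμ`
bricks.  (Cf. ★ `K2E1GroundFieldChangeLocalRingIso.exists_localRingEquiv` ∕ `conjLocal_comm` — the TOWER case `L ⊆ L′` at degree-one places, `Φ = Π ι_{β w′, w′}`; here
`L, L′` are unrelated and `ψ` is arbitrary, at non-split places.)
* **`exists_localRing_equiv_of_adicCompletion_equiv`** — the F-c shell (head posted on the R90 bus 23:49:28Z).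
* `localRing_equiv_conj_of_apply` — the intertwining clause alone, for ANY ring isomorphism `Φ` with `(Φ x)_{w′} = ψ (x_w)` (no continuity needed).
* `localRing_equiv_symm_apply_of_apply` — the value clause for `Φ⁻¹`: `(Φ⁻¹ y)_w = ψ⁻¹ (y_{w′})`.

HONEST LABEL: HC_CM is proved only modulo the 7 printed citations (2 remaining named inputs: hLiu418 = stmt-HodgeConjecture-24832, h413 =
stmt-HodgeConjecture-24833) until rung 0 closes; semilocal plumbing, proves nothing printed; count-neutral helper.

## References
* [CasselsFrohlichANT1967] J. W. S. Cassels, A. Fröhlich (eds.), *Algebraic Number Theory* (1967), Ch. II §10; Ch. VII §1.1, Prop. 1.2 (ii).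
* [Rogawski1990] J. D. Rogawski, *Automorphic Representations of Unitary Groups in Three Variables*, Ann. of Math. Stud. 123 (1990), §13.8 p. 216.
* [PlatonovRapinchuk1994] V. Platonov, A. Rapinchuk, *Algebraic Groups and Number Theory* (1994), §5.1.
-/

set_option autoImplicit false
-- the mandated namespace repeats the single-problem summit's segment (`HodgeConjecture.HodgeConjecture`)
set_option linter.dupNamespace false

noncomputable section

namespace Summit.HodgeConjecture.HodgeConjecture.R90.S3

open IsDedekindDomain NumberField
open Literature.NumberTheory.Automorphic Literature.NumberTheory.Automorphic.UnitaryGroup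

variable (L : Type) [Field L] [NumberField L] [IsCMField L] (v : HeightOneSpectrum (𝓞 ↥(maximalRealSubfield L)))
  (L' : Type) [Field L'] [NumberField L'] [IsCMField L'] (v' : HeightOneSpectrum (𝓞 ↥(maximalRealSubfield L')))
  (w : PlacesOver L v) (hw : IsCMField.complexConj L • w.1 = w.1)
  (w' : PlacesOver L' v') (hw' : IsCMField.complexConj L' • w'.1 = w'.1)

/-! ## §1 The intertwining clause from the value clause -/

include hw hw' in
/-- **`Φ ∘ (c ⊗ 1) = (c′ ⊗ 1) ∘ Φ` from the one-place intertwining.**  At non-split `v, v′` (one place `w ∣ v`, `w′ ∣ v′`), ANY ring isomorphism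
`Φ : L ⊗ L⁺_v ≃+* L′ ⊗ L′⁺_{v′}` whose `w′`-component factors as `(Φ x)_{w′} = ψ (x_w)` through a map `ψ : L_w → L′_{w′}` intertwining
`σ_w = galAdicCompletionMap c hw` with `σ′_{w′}` intertwines the semilocal conjugations `conjLocal` (★ `conjLocal_apply_eq_of_smul_eq`: `((c ⊗ 1) x)_w = σ_w x_w`).
[cite: CasselsFrohlichANT1967, Ch. VII §1.1, Prop. 1.2 (ii)] [cite: PlatonovRapinchuk1994, §5.1] -/
theorem localRing_equiv_conj_of_apply (ψ : w.1.adicCompletion L → w'.1.adicCompletion L')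
    (hψσ : ∀ x, ψ (galAdicCompletionMap (L := L) (IsCMField.complexConj L) hw x) =
      galAdicCompletionMap (L := L') (IsCMField.complexConj L') hw' (ψ x))
    (Φ : UnitaryGroup.LocalRing L v ≃+* UnitaryGroup.LocalRing L' v') (hΦ : ∀ x, Φ x w' = ψ (x w)) (x : UnitaryGroup.LocalRing L v) :
    Φ ((conjLocal L (IsCMField.complexConj L) v) x) = (conjLocal L' (IsCMField.complexConj L') v') (Φ x) := by
  haveI : Algebra.IsQuadraticExtension ↥(maximalRealSubfield L) L := IsCMField.isQuadraticExtension L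
  haveI : Algebra.IsQuadraticExtension ↥(maximalRealSubfield L') L' := IsCMField.isQuadraticExtension L'
  funext u'
  rw [PlacesOver.eq_of_smul_eq (IsCMField.complexConj L') (IsCMField.complexConj_ne_one L') w' hw' u', hΦ, conjLocal_apply_eq_of_smul_eq (IsCMField.complexConj L) (IsCMField.complexConj_ne_one L) v w hw x, hψσ,
    conjLocal_apply_eq_of_smul_eq (IsCMField.complexConj L') (IsCMField.complexConj_ne_one L') v' w' hw' (Φ x), hΦ]

omit [IsCMField L] [IsCMField L'] in
/-- **The value clause for `Φ⁻¹`**: if `(Φ x)_{w′} = ψ (x_w)` for all `x`, then `(Φ⁻¹ y)_w = ψ⁻¹ (y_{w′})` for all `y` (what the `hΦμ`-type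
bricks read: `μ′_{v′} ∘ Φ = μ_v` is a statement about `Φ⁻¹` on `L′_{w′}`).  Pure algebra, any places. [cite: CasselsFrohlichANT1967, Ch. II §10] -/
theorem localRing_equiv_symm_apply_of_apply (ψ : w.1.adicCompletion L ≃+* w'.1.adicCompletion L')
    (Φ : UnitaryGroup.LocalRing L v ≃+* UnitaryGroup.LocalRing L' v') (hΦ : ∀ x, Φ x w' = ψ (x w)) (y : UnitaryGroup.LocalRing L' v') :
    Φ.symm y w = ψ.symm (y w') := by
  have h := hΦ (Φ.symm y)
  rw [Φ.apply_symm_apply] at h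
  rw [h, ψ.symm_apply_apply]

/-! ## §2 The F-c shell: one-place isomorphism ⇒ socket isomorphism -/

include hw hw' in
/-- **(U3) sub-brick F-c — a bi-continuous, conjugation-intertwining `ψ : L_w ≃+* L′_{w′}` at NON-SPLIT places induces the (U3-F) socket's `Φ`.**
For CM fields `L, L′`, finite places `v` of `L⁺` and `v′` of `L′⁺`, places `w ∣ v`, `w′ ∣ v′` fixed by complex conjugation (so `w, w′` are the ONLY places
over `v, v′`), and a ring isomorphism `ψ : L_w ≃+* L′_{w′}` continuous in both directions with `ψ ∘ σ_w = σ′_{w′} ∘ ψ`: there is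
`Φ : L ⊗_{L⁺} L⁺_v ≃+* L′ ⊗_{L′⁺} L′⁺_{v′}` (the tree's `UnitaryGroup.LocalRing = Π_{w ∣ v} L_w`) with `Continuous Φ`, `Continuous Φ.symm`,
`Φ ∘ (c ⊗ 1) = (c′ ⊗ 1) ∘ Φ` (conjuncts 1–3 = the socket's Φ-clauses verbatim) and `(Φ x)_{w′} = ψ (x_w)`.  Proof: `Φ := (RingEquiv.piUnique _)⁻¹ ∘ ψ ∘
RingEquiv.piUnique _` for the `Unique` structures on `PlacesOver` at non-split places; continuity by `Homeomorph.piUnique`; §1 for the intertwining.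
[cite: CasselsFrohlichANT1967, Ch. II §10; Ch. VII §1.1, Prop. 1.2 (ii)] [cite: Rogawski1990, §13.8 p. 216] -/
theorem exists_localRing_equiv_of_adicCompletion_equiv (ψ : w.1.adicCompletion L ≃+* w'.1.adicCompletion L') (hψ : Continuous ψ)
    (hψ' : Continuous ψ.symm)
    (hψσ : ∀ x, ψ (galAdicCompletionMap (L := L) (IsCMField.complexConj L) hw x) =
      galAdicCompletionMap (L := L') (IsCMField.complexConj L') hw' (ψ x)) :
    ∃ Φ : UnitaryGroup.LocalRing L v ≃+* UnitaryGroup.LocalRing L' v',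
      Continuous Φ ∧ Continuous Φ.symm ∧
      (∀ x, Φ ((conjLocal L (IsCMField.complexConj L) v) x) = (conjLocal L' (IsCMField.complexConj L') v') (Φ x)) ∧
      (∀ x, Φ x w' = ψ (x w)) := by
  haveI : Algebra.IsQuadraticExtension ↥(maximalRealSubfield L) L := IsCMField.isQuadraticExtension L
  haveI : Algebra.IsQuadraticExtension ↥(maximalRealSubfield L') L' := IsCMField.isQuadraticExtension L'
  haveI := PlacesOver.subsingleton_of_smul_eq (IsCMField.complexConj L) (IsCMField.complexConj_ne_one L) w hw
  haveI := PlacesOver.subsingleton_of_smul_eq (IsCMField.complexConj L') (IsCMField.complexConj_ne_one L') w' hw'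
  letI : Unique (PlacesOver L v) := uniqueOfSubsingleton w
  letI : Unique (PlacesOver L' v') := uniqueOfSubsingleton w'
  -- `x ↦ x_w : L ⊗ L⁺_v ≃+* L_w` and `x′ ↦ x′_{w′}` (one place over `v`, `v′`)
  let e₁ : UnitaryGroup.LocalRing L v ≃+* w.1.adicCompletion L := RingEquiv.piUnique fun u : PlacesOver L v => u.1.adicCompletion L
  let e₂ : UnitaryGroup.LocalRing L' v' ≃+* w'.1.adicCompletion L' := RingEquiv.piUnique fun u : PlacesOver L' v' => u.1.adicCompletion L'
  have he₁ : Continuous e₁ := (Homeomorph.piUnique fun u : PlacesOver L v => u.1.adicCompletion L).continuous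
  have he₁' : Continuous e₁.symm := (Homeomorph.piUnique fun u : PlacesOver L v => u.1.adicCompletion L).symm.continuous
  have he₂ : Continuous e₂ := (Homeomorph.piUnique fun u : PlacesOver L' v' => u.1.adicCompletion L').continuous
  have he₂' : Continuous e₂.symm := (Homeomorph.piUnique fun u : PlacesOver L' v' => u.1.adicCompletion L').symm.continuous
  have hval : ∀ x, (e₁.trans ψ).trans e₂.symm x w' = ψ (x w) := fun x => by
    change e₂ (e₂.symm (ψ (x w))) = ψ (x w)
    exact e₂.apply_symm_apply _
  refine ⟨(e₁.trans ψ).trans e₂.symm, he₂'.comp (hψ.comp he₁), he₁'.comp (hψ'.comp he₂), ?_, hval⟩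
  exact localRing_equiv_conj_of_apply L v L' v' w hw w' hw' ψ hψσ _ hval

end Summit.HodgeConjecture.HodgeConjecture.R90.S3

end
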